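import Summits.QuantumAdvantage.AdviceFreeQNC0.TwistBoundX3LocalProof
import Summits.QuantumAdvantage.AdviceFreeQNC0.BlockLemmaQuant
import Mathlib.Analysis.SpecialFunctions.Exp
import HarnessLib

/-!
# Cell qa-qnc0, `p = 3` — **`twistBoundX3LocalQ : TwistBoundX3LocalQ`** PROVED: the radius-uniform twist bound
(prover qn-prover-3 g22; statement VERBATIM in `BondTwistLocal.lean` §8, planner qa-qnc0-p1 g20 `exp20/Sketch20x.lean` §8)

With the QUANTITATIVE block lemma `rnsq_blockOpR_le_quant` (`BlockLemmaQuant.lean`: `rnsq (B f) ≤ (1 − 1/(16(2r+1)))·rnsq f`, so the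
block constant `ρ_r = exp(−1/(32(2r+1)))` works since `1 − δ ≤ e^{−δ}`) the main bound `main_bound` of `TwistBoundX3LocalProof.lean`
gives, for every radius `r`, every `N`, every `r`-local rule and every `γ`,

  `‖Σ_x e₃(γ·x)·[odd ∧ WIN]‖ ≤ 9e^{1/32} · 64^r · exp(−(#supp γ − 4r)/(32(2r+1)^3)) · 2^N`,

i.e. `TwistBoundX3LocalQ` with `A = 9e^{1/32}`, `c = 1/32` (the decay proved is in fact `exp(−(#supp γ − 4r − 1)/(32(2r+1)^2))`,
one power of `2r+1` better than typed).

WHAT THIS IS NOT: the main terms `RingWindowLocalLt3` / `RingWindowLocalPolyLt3` and the rungs are open; crux 22907 untouched;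
separation NOT moved.
-/

noncomputable section

namespace Summit.QuantumAdvantage.AdviceFreeQNC0

open Finset Literature.Computability.MetaComplexity Literature.Computability.QuantumComplexity
open Literature.Computability.QuantumComplexity.RingHLF

namespace BondTwist3

open TransferWalk ConstBells TwistedTransfer

/-- The quantitative block constant `ρ_r = exp(−δ/2)`, `δ = 1/(16(2r+1))`, satisfies the block lemma. -/
theorem blockOpR_le_exp (r : ℕ) :
    ∀ (ζ₀ : ℂ), ζ₀ ^ 3 = 1 → ζ₀ ≠ 1 → ∀ (ω : Fin (2 * r) → ℂ), (∀ j, ω j ^ 3 = 1) →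
      ∀ (ε' : Fin (2 * r + 1) → RegState r → Bool → Bool) (g : RegState r → ℂ),
        rnsq (blockOpR ζ₀ ω ε' g) ≤ Real.exp (-(1 / (16 * (2 * (r : ℝ) + 1)) / 2)) ^ 2 * rnsq g := by
  intro ζ₀ h3 h1 ω hω ε' g
  refine (rnsq_blockOpR_le_quant r ζ₀ h3 h1 ω (fun j => norm_eq_one_of_cube (hω j)) ε' g).trans
    (mul_le_mul_of_nonneg_right ?_ (rnsq_nonneg g))
  rw [← Real.exp_nat_mul]
  have h := Real.add_one_le_exp (-(1 / (16 * (2 * (r : ℝ) + 1))))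
  have e : ((2 : ℕ) : ℝ) * -(1 / (16 * (2 * (r : ℝ) + 1)) / 2) = -(1 / (16 * (2 * (r : ℝ) + 1))) := by push_cast; ring
  rw [e]; linarith

/-- The rate arithmetic: `s − 1 ≤ R·c`, `R ≥ 1`, `c ≥ 0` ⇒ `−c/(32R) ≤ 1/32 − s/(32R³)`. -/
theorem rate_ineq (R s c : ℝ) (hR : 1 ≤ R) (hc : 0 ≤ c) (h : s - 1 ≤ R * c) :
    -(1 / (16 * R) / 2 * c) ≤ 1 / 32 + -(1 / 32 * s / R ^ 3) := by
  have hRpos : 0 < R := by linarith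
  have h1 : c * R ≤ c * R ^ 2 := by nlinarith [mul_nonneg hc hRpos.le]
  have hR3 : 1 ≤ R ^ 3 := one_le_pow₀ hR
  have key : s - c * R ^ 2 ≤ R ^ 3 := by nlinarith
  have key2 : s * R - R ^ 3 * c ≤ R ^ 3 * R := by nlinarith [mul_le_mul_of_nonneg_right key hRpos.le]
  have hfrac : s / R ^ 3 - c / R ≤ 1 := by
    rw [div_sub_div _ _ (by positivity) (by positivity), div_le_one (by positivity)]
    exact key2
  have e1 : -(1 / (16 * R) / 2 * c) = -(1 / 32) * (c / R) := by ring
  have e2 : (1 : ℝ) / 32 * s / R ^ 3 = (1 / 32) * (s / R ^ 3) := by ring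
  rw [e1, e2]; linarith

open scoped Classical in
/-- **`twistBoundX3LocalQ : TwistBoundX3LocalQ` — PROVED** (`A = 9e^{1/32}`, `c = 1/32`). -/
theorem twistBoundX3LocalQ : TwistBoundX3LocalQ := by
  classical
  refine ⟨9 * Real.exp (1 / 32), 1 / 32, by norm_num, fun r N t hloc γ => ?_⟩
  set ρ : ℝ := Real.exp (-(1 / (16 * (2 * (r : ℝ) + 1)) / 2)) with hρ
  have hρ0 : 0 ≤ ρ := (Real.exp_pos _).le
  have hblock := blockOpR_le_exp r
  have hR : (0 : ℝ) < 2 * (r : ℝ) + 1 := by positivity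
  have hR1 : (1 : ℝ) ≤ 2 * (r : ℝ) + 1 := by have : (0 : ℝ) ≤ r := Nat.cast_nonneg r; linarith
  set w := (univ.filter fun i : Fin N => γ i ≠ 0).card with hw
  have hwN : w ≤ N := (card_filter_le _ _).trans (by simp)
  have h64 : (1 : ℝ) ≤ 64 ^ r := one_le_pow₀ (by norm_num)
  -- small `N`: the trivial bound (`Y ≥ e^{−3/32}`)
  by_cases hN : N ≤ 4 * r + 3
  · refine (trivial_bound N t γ).trans ?_
    have hY1 : Real.exp (-(3 / 32)) ≤ Real.exp (-(1 / 32 * ((w : ℝ) - 4 * r) / (2 * (r : ℝ) + 1) ^ 3)) := by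
      apply Real.exp_le_exp.2
      have hnum : 1 / 32 * ((w : ℝ) - 4 * r) ≤ 3 / 32 := by
        have : (w : ℝ) ≤ 4 * r + 3 := by exact_mod_cast (hwN.trans hN)
        linarith
      have hR3 : (1 : ℝ) ≤ (2 * (r : ℝ) + 1) ^ 3 := one_le_pow₀ hR1
      by_cases hs : 0 ≤ 1 / 32 * ((w : ℝ) - 4 * r)
      · have : 1 / 32 * ((w : ℝ) - 4 * r) / (2 * (r : ℝ) + 1) ^ 3 ≤ 1 / 32 * ((w : ℝ) - 4 * r) :=
          div_le_self hs hR3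
        linarith
      · have : 1 / 32 * ((w : ℝ) - 4 * r) / (2 * (r : ℝ) + 1) ^ 3 ≤ 0 :=
          div_nonpos_of_nonpos_of_nonneg (le_of_lt (not_le.1 hs)) (by positivity)
        linarith
    have hE : (1 : ℝ) ≤ 9 * Real.exp (1 / 32) * Real.exp (-(3 / 32)) := by
      rw [mul_assoc, ← Real.exp_add]
      have h := Real.add_one_le_exp (1 / 32 + -(3 / 32) : ℝ)
      nlinarith
    have h2N : (0 : ℝ) < (2 : ℝ) ^ N := by positivity
    calc (2 : ℝ) ^ N = 1 * 1 * (2 : ℝ) ^ N := by ring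
      _ ≤ (9 * Real.exp (1 / 32) * Real.exp (-(3 / 32))) * 64 ^ r * (2 : ℝ) ^ N := by gcongr
      _ ≤ (9 * Real.exp (1 / 32) * Real.exp (-(1 / 32 * ((w : ℝ) - 4 * r) / (2 * (r : ℝ) + 1) ^ 3))) *
            64 ^ r * (2 : ℝ) ^ N := by gcongr
      _ = 9 * Real.exp (1 / 32) * 64 ^ r *
            Real.exp (-(1 / 32 * ((w : ℝ) - 4 * r) / (2 * (r : ℝ) + 1) ^ 3)) * (2 : ℝ) ^ N := by ring
  -- `N = n + 1`, `n ≥ 4r + 3`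
  obtain ⟨n, rfl⟩ : ∃ n, N = n + 1 := ⟨N - 1, by omega⟩
  have hn : 4 * r + 3 ≤ n := by omega
  refine (main_bound hρ0 hblock hloc γ hn).trans ?_
  set c := cnt (bsOf r n γ) (2 * r + 1) 0 n with hc
  have hcnt : w - (4 * r + 1) ≤ (2 * r + 1) * c := by
    have h1 := card_starts_le (bsOf r n γ) (show 0 < 2 * r + 1 by omega) n 0
    rw [← hc] at h1
    have h2 := card_supp_le (r := r) γ
    omega
  have hc' : ((w : ℝ) - 4 * r) - 1 ≤ (2 * (r : ℝ) + 1) * c := by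
    by_cases hle : 4 * r + 1 ≤ w
    · have : (((w - (4 * r + 1) : ℕ)) : ℝ) ≤ (((2 * r + 1) * c : ℕ) : ℝ) := by exact_mod_cast hcnt
      rw [Nat.cast_sub hle] at this
      push_cast at this
      linarith
    · have h0 : (0 : ℝ) ≤ (2 * (r : ℝ) + 1) * c := by positivity
      have : (w : ℝ) < 4 * r + 1 := by exact_mod_cast (not_le.1 hle)
      linarith
  -- `ρ^c ≤ e^{1/32} · Y`
  have hρc : ρ ^ c ≤ Real.exp (1 / 32) * Real.exp (-(1 / 32 * ((w : ℝ) - 4 * r) / (2 * (r : ℝ) + 1) ^ 3)) := by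
    rw [hρ, ← Real.exp_nat_mul, ← Real.exp_add]
    apply Real.exp_le_exp.2
    have e : (c : ℝ) * -(1 / (16 * (2 * (r : ℝ) + 1)) / 2) = -(1 / (16 * (2 * (r : ℝ) + 1)) / 2 * c) := by ring
    rw [e]
    exact rate_ineq (2 * (r : ℝ) + 1) ((w : ℝ) - 4 * r) c hR1 (Nat.cast_nonneg c) hc'
  have h2n : (2 : ℝ) ^ n ≤ (2 : ℝ) ^ (n + 1) := pow_le_pow_right₀ (by norm_num) (by omega)
  have h8 : (8 : ℝ) ^ r ≤ 64 ^ r := pow_le_pow_left₀ (by norm_num) (by norm_num) r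
  calc 9 * 8 ^ r * ρ ^ c * (2 : ℝ) ^ n
      ≤ 9 * 64 ^ r * (Real.exp (1 / 32) * Real.exp (-(1 / 32 * ((w : ℝ) - 4 * r) / (2 * (r : ℝ) + 1) ^ 3))) *
          (2 : ℝ) ^ (n + 1) := by gcongr
    _ = 9 * Real.exp (1 / 32) * 64 ^ r *
          Real.exp (-(1 / 32 * ((w : ℝ) - 4 * r) / (2 * (r : ℝ) + 1) ^ 3)) * (2 : ℝ) ^ (n + 1) := by ring

end BondTwist3

end Summit.QuantumAdvantage.AdviceFreeQNC0

end
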